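import Summits.Ventures.AbcSig.Rows.Statements
import Summits.Ventures.AbcSig.Rows.XnYn53Z2EvenX

/-!
# Venture AbcSig — CELL bridge for `xⁿ + yⁿ = 53 z²`, `xy` even: p1's census predicate `Rows.C1CellEven 53 11 ∅`

HONEST FRAMING. COMPUTATION cell `pub-abcsig`; CONDITIONAL theorem; no claim on ABC or any summit. Hypotheses exactly
those of `Rows/XnYn53Z2EvenX.lean` (`xrow_XnYn53Z2Even`): `BS04Package` (CITED), `EisPackage` (CITED), `EisChiPackage` (CITED), `DataComplete` /
`Refines` (COMPUTED, certified level files), and the row's per-orbit CITED exclusions `hX_…` universally quantified in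
the exponent. Conclusion = the census statement of the SIGNED row of record `census/rows/C1/C1-C53-even.md` in p1's
vocabulary (`Rows/Statements.lean`): every prime `n ≥ 11`, `n ∤ 53`, no primitive solution with `xy` even.
GENERATED by p-lean gen3/make_c1cell.py (pattern of `Rows/BridgeC1P2.lean`).
-/

namespace Summit.Ventures.AbcSig

/-- `xⁿ + yⁿ = 53z²`, `xy` even, every prime `n ≥ 11` with `n ∤ 53`: p1's `Rows.C1CellEven 53 11 ∅` from `xrow_XnYn53Z2Even`. -/
theorem C1CellEven_53_of (M : NewformModel) (hP : M.BS04Package)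
    (hE : M.EisPackage)
    (hEχ : M.EisChiPackage)
    (hD5618 : M.DataComplete 5618 level5618Orbits)
    (hRc_orbit_5618_21 : M.Refines 5618 orbit_5618_21 m6chiX_5618_21)
    (hRp_orbit_5618_22 : M.Refines 5618 orbit_5618_22 m6pX_5618_22)
    (hX_orbit_5618_19 : ∀ n : ℕ, n ∈ ([13] : List ℕ) → M.Excludes 5618 orbit_5618_19 (fun S => S.A = 1 ∧ S.B = 1 ∧ S.C = 53 ∧ S.n = n ∧ 2 ∣ S.a * S.b))
    (hX_orbit_5618_20 : ∀ n : ℕ, n ∈ ([13] : List ℕ) → M.Excludes 5618 orbit_5618_20 (fun S => S.A = 1 ∧ S.B = 1 ∧ S.C = 53 ∧ S.n = n ∧ 2 ∣ S.a * S.b)) :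
    Rows.C1CellEven 53 11 ∅ :=
  fun n hn h11 hC _ x y z hpar =>
    xrow_XnYn53Z2Even M hP hE hEχ hD5618 hRc_orbit_5618_21 hRp_orbit_5618_22 n hn h11 (by
      intro hmem
      simp only [List.mem_cons, List.not_mem_nil, or_false] at hmem
      subst hmem
      exact hC (by norm_num)) (hX_orbit_5618_19 n) (hX_orbit_5618_20 n) x y z hpar

end Summit.Ventures.AbcSig
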